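import Mathlib
import Literature.NumberTheory.LFunctions.Zhang2022.Section17Eq171Edges
import Literature.NumberTheory.LFunctions.Zhang2022.Section8AdmissibleRectangle
import Literature.NumberTheory.LFunctions.Zhang2022.TypedSection15AIdentities
import Literature.NumberTheory.LFunctions.Zhang2022.Section4Prop22Eventually
import HarnessLib

/-!
# Zhang (2022) §17 (17.1) HOLDS: `Φ₃ = Σ_{ψ∈Ψ₁}(p_ψt₀)^{β₃}(I₄⁺(ψ) − I₄⁻(ψ)) + O(ε)` — the leaf
# `Typed.Section17.Eq17_1` of `Skeleton.theorem1_of_leaves_v19`, kernel-checked for every large `c′`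

Topic `Literature/NumberTheory/LFunctions/Zhang2022` (Landau–Siegel audit tree; verdict-neutral).
Y. Zhang, *Discrete mean estimates and the Landau–Siegel zero*, arXiv:2211.02515v1 (2022)
[Zhang2022LandauSiegel] — **an unrefereed manuscript under adjudication**; nothing here asserts or
denies its Theorems 1–2. DAG node `Z22:(17.1)` [Z22 p.95, tex L4698–L4706]:

> "Recall that `Φ₃` is given by (13.10). Write `𝔨₃(s,ψ) = …` and `I₄^±(ψ) = (1/2πi)∫_{𝔍(±α)}
> 𝔨₃(s,ψ)ω(s)ds`. Similar to the treatment of `Φ₂`,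
> `Φ₃ = Σ_{ψ∈Ψ₁}(p_ψt₀)^{β₃}(I₄⁺(ψ) − I₄⁻(ψ)) + O(ε)`."  (17.1)

The typed claim is `Typed.Section17.Eq17_1 c′` (TypedSection17, p412282): `∃ c > 0, ∃ C, ForAllLarge
((A) → ‖Φ₃ − Σ_{ψ∈Ψ₁}(p_ψt₀)^{β₃}(I₄⁺(ψ) − I₄⁻(ψ))‖ ≤ Ce^{−c𝓛¹⁰})`. PROVED here, from Proposition 2.2
(a tree theorem for every large `c′`, `Skeleton.prop22_eventually`, `Section4Prop22Eventually`) and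
tree theorems only, by the §17 twin of the kernel-checked (8.1) chain:
* `step17_u002_of_prop22` — per character: the admissible rectangle of §8.u003
  (`Section8aStatements.step8u003_of_prop22`), the residue identity on it (`eq17_1a_at`,
  `Section17Eq171Residue`) and the contour remainder (`eq17_1b_of_prop22`, `Section17Eq171Edges`) give
  `Σ_{ρ∈𝔷(ψ)} 𝔨*₃(ρ,ψ)ω(ρ) = I₄⁺(ψ) − I₄⁻(ψ) + O(e^{−𝓛¹⁰/8})` uniformly in `ψ ∈ Ψ₁`;
* `eq17_1_of_prop22 : 0 ≤ c′ → Skeleton.Prop22 c′ → Eq17_1 c′` — summing over `ψ ∈ Ψ₁` with the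
  weights `|(p_ψt₀)^{β₃}| = 1` (`Φ₃ = Σ_{ψ∈Ψ₁}(p_ψt₀)^{β₃}Σ_ρ𝔨*₃(ρ,ψ)ω(ρ)`, (13.10)): the `#Ψ₁ ≤ 𝔓 ≤ 2P²
  = 2e^{2𝓛⁹}` copies of `e^{−c𝓛¹⁰}` are `≤ 2e^{−(c/2)𝓛¹⁰}` once `𝓛 ≥ 4/c` (the bookkeeping of
  `Typed.Section15A.eq15_3_of_u002`);
* `eq17_1_eventually : ∃ c₀ ≥ 0, ∀ c′ ≥ c₀, Eq17_1 c′` (alias `eq17_1_holds`, the by-name closer) —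
  the shape in which the whole-DAG skeleton consumes the leaf (`h17_1 : ∀ c′ ≥ c₁,
  Typed.Section17.Eq17_1 c′`, with `c′` fixed large inside `theorem1_of_leaves_v19`, exactly as
  Prop. 2.2 (iii)'s threshold is plugged there).

No new definitions, no named facts; axioms standard. ZHANG-L discharge lane (WP16, seat zl-w16-p7), file 3/3 for the leaf
`Typed.Section17.Eq17_1` (FRONTIER h17_1 of `Skeleton.theorem1_of_leaves_v19`). WHAT THIS IS NOT: a
claim about (17.6), (17.9), (17.10), Theorems 1–2 of the source, or Landau–Siegel zeros — (17.1) is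
the residue/contour step only; it is a kernel theorem about a typed-as-printed display of an
unrefereed manuscript.

## References

* Y. Zhang, arXiv:2211.02515v1 (2022), §17 (17.1) p. 95 (tex L4698–L4706); §8 (8.1), §8.u003 p. 42
  (tex L2197–L2206); §13 (13.6), (13.10) p. 74; §2 (2.9), Prop. 2.2. [cite: Zhang2022LandauSiegel, §17 (17.1) p. 95]
-/

noncomputable section

open Complex Real Set

namespace Literature.NumberTheory.LFunctions.Zhang2022.Typed.Section17

open Literature.NumberTheory.LFunctions.Zhang2022 Skeleton
open Literature.NumberTheory.LFunctions.Zhang2022.Section8aStatements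
  (AdmRect rectIntegral step8u003_of_prop22)

/-- `L₀ ≤ log D` once `D ≥ ⌈exp L₀⌉₊`. [folklore] -/
private theorem threshold_le_ell' {L₀ : ℝ} {D : ℕ} (hD : ⌈Real.exp L₀⌉₊ ≤ D) : L₀ ≤ ell D := by
  have h1 : Real.exp L₀ ≤ D := (Nat.le_ceil _).trans (by exact_mod_cast hD)
  have hD0 : (0 : ℝ) < D := (Real.exp_pos _).trans_le h1
  rw [ell, Real.le_log_iff_exp_le hD0]; exact h1

/-- **§17 p.95, the per-character form of (17.1)** ("similar to (8.1)": for `ψ ∈ Ψ₁`,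
`Σ_{ρ∈𝔷(ψ)} 𝔨*₃(ρ,ψ)ω(ρ) = I₄⁺(ψ) − I₄⁻(ψ) + O(ε)`, uniformly in `ψ ∈ Ψ₁`, `ε = e^{−𝓛¹⁰/8}`), from
Proposition 2.2: the admissible rectangle of §8.u003, the residue theorem on it, and the negligible
contour remainder. [cite: Zhang2022LandauSiegel, §17 (17.1) p. 95, tex L4698–L4706] -/
theorem step17_u002_of_prop22 {c' : ℝ} (hc' : 0 ≤ c') (h22 : Prop22 c') :
    ∃ c : ℝ, 0 < c ∧ ∃ C : ℝ, ForAllLarge fun D _ χ => AssumptionA D χ → ∀ x ∈ PsiOne χ,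
      ‖(∑ ρ ∈ finsetOf (zeroSet D x), kstar3 c' χ x ρ * omegaW D ρ) -
          (I4 c' χ x (alpha D) - I4 c' χ x (-alpha D))‖ ≤ C * Real.exp (-c * ell D ^ 10) := by
  obtain ⟨C, c₀, hc₀, h3⟩ := step8u003_of_prop22 hc' h22
  obtain ⟨c, hc, C', hb⟩ := eq17_1b_of_prop22 hc' h22 C c₀ hc₀
  have hii : Prop22ii := h22.2.1
  set L₀ : ℝ := max 80 (4 * π * |C| + 1) with hL₀
  have hthr : ForAllLarge fun D _ _ => 3 ≤ D ∧ 80 ≤ ell D ∧ 4 * π * |C| + 1 ≤ ell D :=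
    ForAllLarge.of_le (max 3 ⌈Real.exp L₀⌉₊) fun D _ χ hD _ _ => by
      have hL : L₀ ≤ ell D := threshold_le_ell' ((le_max_right _ _).trans hD)
      exact ⟨(le_max_left _ _).trans hD, (le_max_left _ _).trans hL, (le_max_right _ _).trans hL⟩
  refine ⟨c, hc, C', (((h3.and hb).and hii).and hthr).mono fun D _ χ _ hp h => ?_⟩
  obtain ⟨⟨⟨h3D, hbD⟩, hiiD⟩, hD3, h80, hCL⟩ := h
  intro hA x hx
  obtain ⟨Lm, Lp, hR⟩ := h3D hA x hx
  obtain ⟨hα0, -, -, hCα⟩ := alpha_sizes171 h80 hCL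
  have hCα' : C * alpha D ≤ 1 / 4 :=
    le_trans (mul_le_mul_of_nonneg_right (le_abs_self C) hα0.le) hCα
  have hℓ1 : (1 : ℝ) ≤ ell1 D := by rw [ell1]; exact one_le_pow₀ (by linarith)
  obtain ⟨hLp1, -⟩ := abs_le.mp (hR.1.trans hCα')
  obtain ⟨-, hLm2⟩ := abs_le.mp (hR.2.1.trans hCα')
  have hLmLp : Lm < Lp := by linarith
  rw [eq17_1a_at χ hD3 hp c' x hc₀ hα0 hLmLp (fun s hs => hiiD x hx s hs) hR]
  exact hbD x hx Lm Lp hR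

/-- **(17.1) HOLDS given Proposition 2.2**: for `c′ ≥ 0`, `Skeleton.Prop22 c′ → Typed.Section17.Eq17_1 c′`
— summing the per-character identity over `ψ ∈ Ψ₁` with the unimodular weights `(p_ψt₀)^{β₃}`
(`Φ₃ = Σ_{ψ∈Ψ₁}(p_ψt₀)^{β₃}Σ_{ρ∈𝔷(ψ)}𝔨*₃(ρ,ψ)ω(ρ)`, (13.10)); `#Ψ₁ ≤ 𝔓 ≤ 2P²` copies of
`e^{−c𝓛¹⁰}` are `≤ 2e^{−(c/2)𝓛¹⁰}` once `𝓛 ≥ 4/c`. [cite: Zhang2022LandauSiegel, §17 (17.1) p. 95, tex L4706] -/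
theorem eq17_1_of_prop22 {c' : ℝ} (hc' : 0 ≤ c') (h22 : Prop22 c') : Eq17_1 c' := by
  obtain ⟨c, hc, C, D₀, hD₀⟩ := step17_u002_of_prop22 hc' h22
  obtain ⟨D₁, hD₁⟩ := Typed.Section15A.frakP_le_two_mul_bigP_sq
  refine ⟨c / 2, by positivity, 2 * max C 0, max D₀ (max D₁ ⌈Real.exp (4 / c)⌉₊),
    fun D _ χ hD hq hp hA => ?_⟩
  have hb := hD₀ D χ (le_trans (le_max_left _ _) hD) hq hp hA
  have hfrakP := hD₁ D (le_trans (le_trans (le_max_left _ _) (le_max_right _ _)) hD)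
  have hℓ : 4 / c ≤ ell D :=
    threshold_le_ell' (le_trans (le_trans (le_max_right _ _) (le_max_right _ _)) hD)
  have hℓ0 : 0 < ell D := lt_of_lt_of_le (by positivity) hℓ
  set E : ℝ := Real.exp (-c * ell D ^ 10) with hE
  have hE0 : 0 < E := Real.exp_pos _
  have hC : C ≤ max C 0 := le_max_left _ _
  have hC0 : 0 ≤ max C 0 := le_max_right _ _
  -- `Φ₃` as a sum over `Ψ₁` of the weighted sums over `𝔷(ψ)`
  have hPhi : Phi3 c' χ = ∑ x ∈ finsetOf (PsiOne χ),
      (((x.p : ℝ) * t0 D : ℝ) : ℂ) ^ beta3 c' D *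
        ∑ ρ ∈ finsetOf (zeroSet D x), kstar3 c' χ x ρ * omegaW D ρ := by
    rw [Phi3, idx, Finset.sum_sigma]
    refine Finset.sum_congr rfl fun x _ => ?_
    rw [Finset.mul_sum]
    refine Finset.sum_congr rfl fun ρ _ => ?_
    dsimp only
    ring
  rw [hPhi, ← Finset.sum_sub_distrib]
  -- the unimodular weights `(p_ψt₀)^{β₃}`
  have hw : ∀ x : Chr D, ‖(((x.p : ℝ) * t0 D : ℝ) : ℂ) ^ beta3 c' D‖ = 1 := by
    intro x
    have hpt : 0 < (x.p : ℝ) * t0 D :=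
      mul_pos (Nat.cast_pos.mpr x.prime.pos) (by rw [t0]; positivity)
    rw [Complex.norm_cpow_eq_rpow_re_of_pos hpt]
    have : (beta3 c' D).re = 0 := by simp [beta3]
    rw [this, Real.rpow_zero]
  -- the count: `#Ψ₁ · ε ≤ 𝔓 ε ≤ 2P² ε ≤ 2 e^{−(c/2)𝓛¹⁰}`
  have hcount : ((finsetOf (PsiOne χ)).card : ℝ) * (max C 0 * E) ≤
      2 * max C 0 * Real.exp (-(c / 2) * ell D ^ 10) := by
    have h1 : ((finsetOf (PsiOne χ)).card : ℝ) ≤ 2 * bigP D ^ 2 :=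
      le_trans (Ded81Edge.card_finsetOf_psiOne_le_frakP χ) hfrakP
    have h2 : bigP D ^ 2 * E ≤ Real.exp (-(c / 2) * ell D ^ 10) := by
      rw [hE, bigP, ← Real.exp_nat_mul, ← Real.exp_add, Real.exp_le_exp]
      have h9 : 0 < ell D ^ 9 := by positivity
      have hcl : 4 ≤ c * ell D := by
        have := (div_le_iff₀ hc).mp hℓ
        linarith
      have : (2 : ℝ) * ell D ^ 9 ≤ (c / 2) * ell D ^ 10 := by
        have : (c / 2) * ell D ^ 10 = (c * ell D / 2) * ell D ^ 9 := by ring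
        rw [this]
        exact mul_le_mul_of_nonneg_right (by linarith) h9.le
      push_cast
      linarith
    calc ((finsetOf (PsiOne χ)).card : ℝ) * (max C 0 * E)
        ≤ 2 * bigP D ^ 2 * (max C 0 * E) := mul_le_mul_of_nonneg_right h1 (by positivity)
      _ = 2 * max C 0 * (bigP D ^ 2 * E) := by ring
      _ ≤ 2 * max C 0 * Real.exp (-(c / 2) * ell D ^ 10) :=
          mul_le_mul_of_nonneg_left h2 (by positivity)
  calc ‖∑ x ∈ finsetOf (PsiOne χ),
        ((((x.p : ℝ) * t0 D : ℝ) : ℂ) ^ beta3 c' D *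
            ∑ ρ ∈ finsetOf (zeroSet D x), kstar3 c' χ x ρ * omegaW D ρ -
          (((x.p : ℝ) * t0 D : ℝ) : ℂ) ^ beta3 c' D * (I4 c' χ x (alpha D) - I4 c' χ x (-alpha D)))‖
      ≤ ∑ x ∈ finsetOf (PsiOne χ),
          ‖(((x.p : ℝ) * t0 D : ℝ) : ℂ) ^ beta3 c' D *
              ∑ ρ ∈ finsetOf (zeroSet D x), kstar3 c' χ x ρ * omegaW D ρ -
            (((x.p : ℝ) * t0 D : ℝ) : ℂ) ^ beta3 c' D *
              (I4 c' χ x (alpha D) - I4 c' χ x (-alpha D))‖ := norm_sum_le _ _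
    _ ≤ ∑ x ∈ finsetOf (PsiOne χ), max C 0 * E :=
        Finset.sum_le_sum fun x hx => by
          rw [← mul_sub, norm_mul, hw x, one_mul]
          exact le_trans (hb x (mem_of_mem_finsetOf hx)) (mul_le_mul_of_nonneg_right hC hE0.le)
    _ = ((finsetOf (PsiOne χ)).card : ℝ) * (max C 0 * E) := by
        rw [Finset.sum_const, nsmul_eq_mul]
    _ ≤ 2 * max C 0 * Real.exp (-(c / 2) * ell D ^ 10) := hcount

/-- **(17.1) is a theorem for every sufficiently large `c′`** (the shape in which the whole-DAG
skeleton carries the leaf: `∀ c′ ≥ c₁, Typed.Section17.Eq17_1 c′`, `c′` = the constant of (2.13),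
"for some (large) constant `c′ > 0`", §2 p. 7): `eq17_1_of_prop22` ∘ `Skeleton.prop22_eventually`.
[cite: Zhang2022LandauSiegel, §17 (17.1) p. 95, tex L4706] -/
theorem eq17_1_eventually : ∃ c₀ : ℝ, 0 ≤ c₀ ∧ ∀ c' : ℝ, c₀ ≤ c' → Eq17_1 c' := by
  obtain ⟨c₀, h0, h⟩ := prop22_eventually
  exact ⟨c₀, h0, fun c' hc' => eq17_1_of_prop22 (h0.trans hc') (h c' hc')⟩

/-- **`Z22:(17.1)` HOLDS** — the leaf `Typed.Section17.Eq17_1` of `Skeleton.theorem1_of_leaves_v19` BY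
NAME, for every `c′` beyond a threshold `c₀ ≥ 0` (skeleton plug: `obtain ⟨c₁₇, -, h17all⟩ :=
Typed.Section17.eq17_1_holds`, then fix `c′ ≥ max … c₁₇` and `h17_1 := h17all c′ hc₁₇`).
[cite: Zhang2022LandauSiegel, §17 (17.1) p. 95, tex L4706] -/
theorem eq17_1_holds : ∃ c₀ : ℝ, 0 ≤ c₀ ∧ ∀ c' : ℝ, c₀ ≤ c' → Eq17_1 c' := eq17_1_eventually

end Literature.NumberTheory.LFunctions.Zhang2022.Typed.Section17
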